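import Summits.Schanuel.Schanuel.Theorems.ZilberEacParamRamifiedTrichotomy
import HarnessLib

/-!
# Arbitrary base branches, II: the growth / resonance / Kronecker TRICHOTOMY for an ABSTRACT
# irreducible surface

HONEST FRAMING.  Cell `pub-schanuel` (Zilber's Exponential-Algebraic Closedness, case ladder;
host summit Schanuel), seat 2, gen 28.  Files LX (graphs) and LXXVI (polynomial curves) prove:
a ramified witness — exponential points `q_j` of the surface with `x₀(q_j) = U₀(μ_j)μ_j^{-K} → ∞`,
`μ_j → 0`, and the exact additive identity `x₁(q_j) = Π(m₀ + j) + r(μ_j)` (`Π ∈ ℂ[X]`, `r` analytic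
at `0`) — gives Zariski density of the exponential points UNLESS an analytic relation
`H(U₀(u)u^{-K}, e^{r(u)}) = 0` holds on a punctured neighbourhood of `u = 0`.  Both proofs use the
surface only through "irreducible, Zariski closed, of dimension `≤ 2`, containing the `q_j`".  This
file records the statement in exactly that generality:
**`unprojectedDense_of_ramified_witness_abstract`** — for ANY irreducible closed
`S ⊆ ℂ² × ℂ²` of dimension `≤ 2`.  Proof verbatim from file LXXVI: (a) GROWTH — `Re Π` non-constant:
THEOREM G (`unprojectedDense_of_growth`); (b) RESONANCE — `Re Π` constant and the phases
`e^{i Im Π(m)}` periodic: a subsequence of constant phase and THEOREM T in ramified form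
(`unprojectedDense_of_transcendental_relation_pole`); (c) KRONECKER — an irrational coefficient:
a relation on all points would make the phases accumulate at a finite set
(`phases_near_finset_of_relation`), but they do not (`urot_eval_periodic_or_not_near_finset`).
It is the trichotomy step of the transcendence method over an ARBITRARY base branch (file IV of
this series).  [folklore analysis] (new in this form); nothing here is specific to Schanuel's
conjecture (neither used nor implied); Mantova–Masser's question (PLMS 2024 §1 p. 5) and EC(3,2)
stay OPEN.
-/

noncomputable section

open Filter Topology Polynomial MvPolynomial Bornology
open Literature.NumberTheory.Transcendental Literature.ModelTheory.Zilber
open Literature.ModelTheory.ExponentialFields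

set_option linter.dupNamespace false

namespace Summit.Schanuel.Schanuel.Theorems

/-- **Density from a transcendental ramified witness, for an abstract irreducible surface**
(growth / resonance / Kronecker trichotomy).  See the module docstring.
[cite: MantovaMasser2023, §1 Further remarks, p. 5 (the question, open in general)]
(new in this form) -/
theorem unprojectedDense_of_ramified_witness_abstract {S : Set (Fin 2 ⊕ Fin 2 → ℂ)}
    (hS : IsIrreducibleClosed ℂ S) (hdim : zariskiDim ℂ S ≤ (2 : ℕ))
    (Pl : Polynomial ℂ) {U₀ r : ℂ → ℂ} (hU : AnalyticAt ℂ U₀ 0) (hr : AnalyticAt ℂ r 0) {K : ℕ}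
    (htr : ∀ H : Polynomial (Polynomial ℂ), H ≠ 0 →
      ¬ (∀ᶠ u in 𝓝[≠] (0 : ℂ),
        (H.map (Polynomial.evalRingHom (U₀ u * u⁻¹ ^ K))).eval (Complex.exp (r u)) = 0))
    (m₀ : ℕ) {μ : ℕ → ℂ} (hμ0 : ∀ j, μ j ≠ 0) (hμ : Tendsto μ atTop (𝓝 0))
    {q : ℕ → Fin 2 ⊕ Fin 2 → ℂ} (hqS : ∀ j, q j ∈ S) (hqΓ : ∀ j, q j ∈ expGraph ℂ 2)
    (hx : ∀ j, q j (Sum.inl 0) = U₀ (μ j) * (μ j)⁻¹ ^ K)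
    (hnorm : Tendsto (fun j => ‖q j (Sum.inl 0)‖) atTop atTop)
    (hid₁ : ∀ j, q j (Sum.inl 1) = Pl.eval ((m₀ + j : ℕ) : ℂ) + r (μ j)) :
    UnprojectedDense S := by
  classical
  -- the phase polynomial `j ↦ Π(j)` and its real and imaginary parts
  obtain ⟨gR, gI, hgR, hexpPK⟩ := exists_re_im_polynomials Pl
  -- the witness `w = e^r`
  set w : ℂ → ℂ := fun u => Complex.exp (r u) with hw
  have hwan : AnalyticAt ℂ w 0 := hr.cexp
  have hw0 : ∀ u, w u ≠ 0 := fun u => Complex.exp_ne_zero _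
  have hcast : ∀ j, ((m₀ + j : ℕ) : ℂ) = (((m₀ + j : ℕ) : ℝ) : ℂ) := fun j => by
    rw [Complex.ofReal_natCast]
  -- `y₁ = e^{x₁}` on the exponential points
  have hexp₁ : ∀ j, q j (Sum.inr 1) = Complex.exp (q j (Sum.inl 1)) := fun j => by
    have h := (mem_expGraph_iff.1 (hqΓ j)) 1
    rw [h, Literature.ModelTheory.ExponentialFields.ExponentialRing.complex_exp_eq]
  -- the exact identity with labels `m₀ + j`, through the real polynomials
  have hid : ∀ j, q j (Sum.inr 1) =
      urot (gI.eval ((m₀ + j : ℕ) : ℝ)) *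
        ((Real.exp (gR.eval ((m₀ + j : ℕ) : ℝ)) : ℂ) * w (μ j)) := by
    intro j
    rw [hexp₁ j, hid₁ j, Complex.exp_add, hcast, hexpPK]
    ring
  have hwlim : Tendsto (fun m => w (μ m)) atTop (𝓝 (w 0)) := hwan.continuousAt.tendsto.comp hμ
  have hrlim : Tendsto (fun m => r (μ m)) atTop (𝓝 (r 0)) := hr.continuousAt.tendsto.comp hμ
  by_cases hgRdeg : 1 ≤ gR.natDegree
  · /- (a) GROWTH: some order of `Re x₁(q_j)` survives; THEOREM G -/
    have hre : ∀ m, (q m (Sum.inl 1)).re = gR.eval ((m₀ + m : ℕ) : ℝ) + (r (μ m)).re := by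
      intro m
      rw [hid₁ m, Complex.add_re, hcast, hgR]
    obtain ⟨M, hM⟩ : ∃ M : ℝ, ∀ m, ‖r (μ m)‖ ≤ M := by
      obtain ⟨C, hC⟩ := isBounded_iff_forall_norm_le.1 (Metric.isBounded_range_of_tendsto _ hrlim)
      exact ⟨C, fun m => hC _ ⟨m, rfl⟩⟩
    have hM0 : 0 ≤ M := (norm_nonneg _).trans (hM 0)
    have ha : ∀ m, |(q m (Sum.inl 1)).re - gR.eval ((m₀ + m : ℕ) : ℝ)| ≤ M := by
      intro m
      rw [hre m, add_sub_cancel_left]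
      exact (Complex.abs_re_le_norm _).trans (hM m)
    -- the denominator: `‖x₁(q_j)‖ ≤ ‖Π(m₀ + j)‖ + M`
    obtain ⟨D, hD, hLD⟩ := log_two_add_norm_eval_le_log_label Pl (le_refl (0 : ℝ))
    have hLD' : ∀ m, Real.log (2 + ‖q m (Sum.inl 1)‖) ≤
        (D + Real.log (1 + M)) * Real.log (3 + 3 * ((m₀ + m : ℕ) : ℝ)) := by
      intro m
      have hlab0 : (0 : ℝ) ≤ ((m₀ + m : ℕ) : ℝ) := Nat.cast_nonneg _
      have h1 : Real.log (2 + ‖Pl.eval ((m₀ + m : ℕ) : ℂ)‖) ≤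
          D * Real.log (3 + 3 * ((m₀ + m : ℕ) : ℝ)) := by
        refine hLD _ _ hlab0 ?_
        rw [Complex.norm_natCast, zero_add]
        linarith
      have h2 : ‖q m (Sum.inl 1)‖ ≤ ‖Pl.eval ((m₀ + m : ℕ) : ℂ)‖ + M := by
        rw [hid₁ m]
        exact (norm_add_le _ _).trans (by linarith [hM m])
      calc Real.log (2 + ‖q m (Sum.inl 1)‖)
          ≤ Real.log (2 + ‖Pl.eval ((m₀ + m : ℕ) : ℂ)‖ + M) :=
            Real.log_le_log (by positivity) (by linarith)
        _ ≤ (D + Real.log (1 + M)) * Real.log (3 + 3 * ((m₀ + m : ℕ) : ℝ)) :=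
            log_two_add_add_le (norm_nonneg _) hM0 (one_le_log_three_add _ hlab0) h1
    have hD' : 0 < D + Real.log (1 + M) := by
      have := Real.log_nonneg (by linarith : (1 : ℝ) ≤ 1 + M)
      linarith
    have hgr : Tendsto (fun m => |(q m (Sum.inl 1)).re| / Real.log (2 + ‖q m (Sum.inl 1)‖))
        atTop atTop :=
      tendsto_abs_div_log_of_linear_growth hgRdeg m₀ hD' ha
        (fun m => Real.log_le_log two_pos (by linarith [norm_nonneg (q m (Sum.inl 1))])) hLD'
    exact unprojectedDense_of_growth hS hdim 1 hqS hqΓ hgr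
  · /- `g_R` is constant: the modulus of the phase factor is constant -/
    have hgR0 : gR.natDegree = 0 := by omega
    set r₀ : ℝ := gR.coeff 0 with hr₀
    have hgRev : ∀ x : ℝ, gR.eval x = r₀ := fun x => by
      rw [Polynomial.eq_C_of_natDegree_eq_zero hgR0, Polynomial.eval_C]
    set c₀ : ℂ := ((Real.exp r₀ : ℝ) : ℂ) with hc₀
    have hc₀0 : c₀ ≠ 0 := by rw [hc₀]; exact_mod_cast (Real.exp_pos r₀).ne'
    have hid' : ∀ m, q m (Sum.inr 1) = urot (gI.eval ((m₀ + m : ℕ) : ℝ)) * (c₀ * w (μ m)) := by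
      intro m; rw [hid m, hgRev]
    rcases urot_eval_periodic_or_not_near_finset gI with ⟨Dp, hDp, hper⟩ | hfar
    · /- (b) RESONANCE: periodic phases; constant phase on a subsequence; THEOREM T (file LIX) -/
      set phase : ℕ → ℂ := fun k => urot (gI.eval (k : ℝ)) with hphase
      have hperiodic : Function.Periodic phase Dp := fun k => hper k
      set g : ℕ → Fin Dp := fun m => ⟨(m₀ + m) % Dp, Nat.mod_lt _ hDp⟩ with hg
      obtain ⟨i₀, hi₀⟩ := Finite.exists_infinite_fiber g
      have hSinf : Set.Infinite (g ⁻¹' {i₀}) := Set.infinite_coe_iff.1 hi₀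
      set ζ : ℂ := phase (i₀ : ℕ) * c₀ with hζ
      have hζ0 : ζ ≠ 0 :=
        mul_ne_zero (by rw [hphase]; exact (norm_pos_iff.1 (by rw [norm_urot]; norm_num))) hc₀0
      have hphase_eq : ∀ m, g m = i₀ → phase (m₀ + m) = phase (i₀ : ℕ) := by
        intro m hm
        have h1 : ((i₀ : ℕ)) = (m₀ + m) % Dp := by rw [← hm]
        rw [h1]
        exact (hperiodic.map_mod_nat (m₀ + m)).symm
      -- the subsequence of constant phase
      set φ : ℕ → ℕ := Nat.nth (· ∈ g ⁻¹' {i₀}) with hφ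
      have hφS : ∀ j, g (φ j) = i₀ := fun j =>
        Nat.nth_mem_of_infinite (p := (· ∈ g ⁻¹' {i₀})) hSinf j
      have hφtop : Tendsto φ atTop atTop :=
        (Nat.nth_strictMono (p := (· ∈ g ⁻¹' {i₀})) hSinf).tendsto_atTop
      have hqnorm : Tendsto (fun j => ‖q (φ j) (Sum.inl 0)‖) atTop atTop := hnorm.comp hφtop
      have hw' : AnalyticAt ℂ (fun u => ζ * w u) 0 := analyticAt_const.mul hwan
      have hx' : ∀ j, q (φ j) (Sum.inl 0) = U₀ (μ (φ j)) * (μ (φ j))⁻¹ ^ K := fun j => hx (φ j)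
      have hrel : ∀ j, q (φ j) (Sum.inr 1) = (fun u => ζ * w u) (μ (φ j)) := by
        intro j
        simp only
        rw [hid' (φ j), hζ]
        have := hphase_eq (φ j) (hφS j)
        simp only [hphase, Nat.cast_add] at this
        push_cast
        rw [this]
        ring
      have htr' : ∀ H : Polynomial (Polynomial ℂ), H ≠ 0 →
          ¬ (∀ᶠ u in 𝓝[≠] (0 : ℂ),
            (H.map (Polynomial.evalRingHom (U₀ u * u⁻¹ ^ K))).eval (w u) = 0) := htr
      exact unprojectedDense_of_transcendental_relation_pole hS hdim 0 1 (fun j => hqS (φ j))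
        (fun j => hqΓ (φ j)) hqnorm hU hw' K (fun j => hμ0 (φ j)) (hμ.comp hφtop) hx' hrel
        (transcendental_pole_const_mul hζ0 htr')
    · /- (c) NON-RESONANCE: a relation on all large labels would make the phases accumulate -/
      by_contra hnot
      have hex : ∃ f, f ∈ vanishingIdeal ℂ (S ∩ expGraph ℂ 2) ∧ f ∉ vanishingIdeal ℂ S := by
        by_contra h
        push Not at h
        exact hnot (le_antisymm h (vanishingIdeal_anti_mono Set.inter_subset_left))
      obtain ⟨f, hfΓ, hfS⟩ := hex
      -- THEOREM H: one relation on all points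
      obtain ⟨H, hH0, hH⟩ := exists_polyPoly_relation_of_forall_aeval_eq_zero hS hdim hqS hfS
        (fun m => (mem_vanishingIdeal_iff.1 hfΓ) _ ⟨hqS m, hqΓ m⟩) (Sum.inl 0) (Sum.inr 1)
      set e : ℕ → ℂ := fun m => urot (gI.eval ((m₀ + m : ℕ) : ℝ)) with he
      have he1 : ∀ m, ‖e m‖ = 1 := fun m => norm_urot _
      have hrel : ∀ m, (H.map (Polynomial.evalRingHom (q m (Sum.inl 0)))).eval
          (e m * (c₀ * w (μ m))) = 0 := by
        intro m
        have h1 := hH m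
        rwa [hid' m] at h1
      -- the phases accumulate at a finite set …
      have hwlim' : Tendsto (fun m => c₀ * w (μ m)) atTop (𝓝 (c₀ * w 0)) := hwlim.const_mul c₀
      obtain ⟨F, hF⟩ := phases_near_finset_of_relation hH0 hnorm he1 (mul_ne_zero hc₀0 (hw0 0))
        hwlim' hrel
      -- … but the non-resonant phase sequence does not
      obtain ⟨ε, hε, hfar'⟩ := hfar F
      obtain ⟨m₁, hm₁⟩ := Filter.eventually_atTop.1 (hF ε hε)
      obtain ⟨k', hk', hkfar⟩ := hfar' (m₀ + m₁)
      obtain ⟨ζ, hζF, hζ⟩ := hm₁ (k' - m₀) (by omega)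
      have hkk : m₀ + (k' - m₀) = k' := by omega
      rw [he] at hζ
      simp only [hkk] at hζ
      exact absurd hζ (not_lt.2 (hkfar ζ hζF))

end Summit.Schanuel.Schanuel.Theorems
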